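import Summits.ResolutionOfSingularities.ResolutionOfSingularities.Theorems.WildLogDiagonalLU2
import HarnessLib

/-!
# WildLogDiagonalLU3 — PART B: THE CHART `chart_isRegularLocalRing_and_generates` — the `σ`-stable model `T[x′, (1 + σⁱη)⁻¹]`, dominated, REGULAR of dimension `d` by the tree's toric theorem BY NAME, on which ONE twist generates the augmentation ideal

One of the five landing files of the g32 node «LogDiagonalCut» of the ROOT/RESIDUAL decomposition cell `decomp-res`
(lens 1; door (W-wild-PROD) of NEXT-g32, critic letters 229a / 229b, ROW 234; files `WildLogDiagonalLU`, `…LU2`,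
`…LU3`, `…LU4`, `…LU5`); see the module docstring of `Summits.ResolutionOfSingularities.ResolutionOfSingularities.Theorems.WildLogDiagonalLU`
for the thesis (the binomial log-diagonal wild `ℤ/p` cell decided hypothesis-free by PRODUCTION of the pseudo-reflection
model — toric chart + Frobenius normal form + Nakayama + derivation rule — then the g31 law / [KiralyLutkebohmert2013,
Thm. 2] BY NAME), the cell `WildLogDiagonalLUAbove k O` and the law `relLU_of_wildLogDiagonalLUAbove` (in `…LU4`), the
toy census, the instances, the control certificate and the typed complement kinds, the honest scope and the sources.
This file: `mem_iff_pow_apply_mem`, `pow_apply_mem_of_stable`, `zpow_mem_of_inv_mem`, `chart_isRegularLocalRing_and_generates`.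
Imports: the slice `…WildLogDiagonalLU2`.  Problem side, sorry-free, hypothesis-free (zero fact binders); every heavy theorem carries
`set_option maxHeartbeats … in` BEFORE its docstring — keep it.
-/

noncomputable section

open Literature.AlgebraicGeometry.Resolution
open Summit.ResolutionOfSingularities.ResolutionOfSingularities.Theorems.InertDescentLU
open Summit.ResolutionOfSingularities.ResolutionOfSingularities.Theorems.InvariantDescentLU
open Summit.ResolutionOfSingularities.ResolutionOfSingularities.Theorems.WildReflectionLU

universe u

namespace Summit.ResolutionOfSingularities.ResolutionOfSingularities.Theorems.WildLogDiagonalLU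

variable {E : Type u} [Field E]

/-! ## PART B — THE CHART: a `σ`-stable regular model on which ONE twist generates the augmentation ideal -/

section Chart

open IsLocalRing Polynomial

variable (O : ValuationSubring E) {S T : Subring E} {σ : E ≃+* E}

/-- Iterates of an automorphism preserving `O` (both ways) preserve `O` (both ways). [folklore] -/
theorem mem_iff_pow_apply_mem (hσO : ∀ z : E, z ∈ O ↔ σ z ∈ O) (i : ℕ) (z : E) :
    z ∈ O ↔ (σ ^ i) z ∈ O := by
  induction i generalizing z with
  | zero => rw [pow_zero, RingAut.one_apply]
  | succ i ih => rw [pow_succ, RingAut.mul_apply]; exact (hσO z).trans (ih (σ z))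

/-- Iterates of an automorphism preserving a subring preserve it. [folklore] -/
theorem pow_apply_mem_of_stable (hσT : ∀ z ∈ T, σ z ∈ T) (i : ℕ) {z : E} (hz : z ∈ T) :
    (σ ^ i) z ∈ T := by
  induction i with
  | zero => rwa [pow_zero, RingAut.one_apply]
  | succ i ih => rw [pow_succ', RingAut.mul_apply]; exact hσT _ ih

/-- A subring containing `u` and `u⁻¹` contains every integer power of `u`. [folklore] -/
theorem zpow_mem_of_inv_mem (B : Subring E) {u : E} (hu : u ∈ B) (hinv : u⁻¹ ∈ B) (n : ℤ) :
    u ^ n ∈ B := by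
  obtain ⟨m, rfl | rfl⟩ := n.eq_nat_or_neg
  · rw [zpow_natCast]; exact B.pow_mem hu m
  · rw [zpow_neg, zpow_natCast, ← inv_pow]; exact B.pow_mem hinv m

variable (p : ℕ) [hp : Fact p.Prime] [CharP E p]

set_option maxHeartbeats 1600000 in
/-- **THE CHART THEOREM — PRODUCTION of a pseudo-reflection model** (the kernel of the node, hypothesis-free).
Frame: a valued field `(E, O)` of characteristic `p`; `σ` an automorphism of `E` of order dividing `p` preserving
`O`; a base ring `S` FIXED pointwise by `σ` such that every element of `O` is congruent modulo `𝔪_O` to an element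
of `S` (residues rational); a `σ`-stable model `S ⊆ T ⊆ O` whose local ring `B = T_𝔪′` at the centre is REGULAR
of dimension `d` and universally catenary, with a system `x₁, …, x_d` generating the centre; a FRAME
`x′₁, …, x′_d ∈ 𝔪_O ∖ 0` of fractions of `T` of which the `xᵢ = ∏ x′_j^{A i j}` are monomials; a PIVOT
`η = w·∏ x′_j^{a′_j} ∈ T` (`w ∈ B^×`, `v(η) < 1`); the BINOMIAL LOG-DIAGONAL action `σ x′_j = x′_j·(1 + η)^{N_j}`;
and the `p`-LUCKY clause on `(N, a′)`.  THEN the model `T′ := T[x′, (1 + σ^i η)⁻¹ : i < p]` is contained in `O`,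
`σ`-STABLE, REGULAR at the centre of `O` (the tree's toric chart theorem
`isRegularLocalRing_locAtCentre_adjoin_monomials` by name, dimension by the tree's
`ringKrullDim_locAtCentre_closure_eq` by name, base change by `locAtCentre_closure_locAtCentre_union` by name), and
the augmentation `σ x′_{j₀} − x′_{j₀}` of the lucky coordinate is NON-ZERO and generates: `σ b − b ∈
(σ x′_{j₀} − x′_{j₀})·T′_𝔪′` for every `b ∈ T′` (Nakayama generation on `B`, derivation rule along the closure,
Frobenius normal form and lucky divisibility on `T′_𝔪′`).  This is the PRODUCTION half that the g31 cell
`WildPseudoReflectionLUAbove` assumed. [cite: KiralyLutkebohmert2013, Thm. 2 (a), Ex. 6, pp. 64–66]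
[cite: CossartPiltant2008, proof of Lemma 9.4 (HAL p. 29)] -/
theorem chart_isRegularLocalRing_and_generates (hσO : ∀ z : E, z ∈ O ↔ σ z ∈ O) (hσp : σ ^ p = 1)
    (hST : S ≤ T) (hσS : ∀ s ∈ S, σ s = s) (hTO : T ≤ O.toSubring) (hσT : ∀ z ∈ T, σ z ∈ T)
    (hreg : IsRegularLocalRing (locAtCentre T O)) (hTuc : IsUniversallyCatenaryRing (locAtCentre T O))
    (hres : ∀ y ∈ O, ∃ c ∈ S, O.valuation (y - c) < 1)
    {d : ℕ} {x x' : Fin d → E} {A : Fin d → Fin d → ℕ} {η w : E} {a' : Fin d → ℕ} {N : Fin d → ℤ}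
    (hdim : ringKrullDim (locAtCentre T O) = d)
    (hx : ∀ i, x i ∈ locAtCentre T O ∧ O.valuation (x i) < 1)
    (hgen : ∀ b ∈ locAtCentre T O, O.valuation b < 1 →
      ∃ c : Fin d → E, (∀ i, c i ∈ locAtCentre T O) ∧ b = ∑ i, c i * x i)
    (hx' : ∀ j, x' j ≠ 0 ∧ x' j ∈ O ∧ O.valuation (x' j) < 1 ∧ ∃ a b : E, a ∈ T ∧ b ∈ T ∧ x' j = a / b)
    (hmon : ∀ i, x i = ∏ j, x' j ^ A i j)
    (hpiv : η ∈ T ∧ O.valuation η < 1 ∧ w ∈ locAtCentre T O ∧ O.valuation w = 1 ∧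
      η = w * ∏ j, x' j ^ a' j)
    (htw : ∀ j, σ (x' j) = x' j * (1 + η) ^ N j) (hL : Lucky p N a')
    (T' : Subring E) (hT' : T' = Subring.closure ((T : Set E) ∪
      (Set.range x' ∪ Set.range fun i : Fin p => (1 + (σ ^ (i : ℕ)) η)⁻¹))) :
    T' ≤ O.toSubring ∧ (∀ z ∈ T', σ z ∈ T') ∧ IsRegularLocalRing (locAtCentre T' O) ∧
      ∃ j₀ : Fin d, x' j₀ ∈ T' ∧ σ (x' j₀) ≠ x' j₀ ∧
        ∀ b ∈ T', ∃ c ∈ locAtCentre T' O, σ b - b = (σ (x' j₀) - x' j₀) * c := by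
  classical
  subst hT'
  set z : Fin p → E := fun i => (1 + (σ ^ (i : ℕ)) η)⁻¹ with hzdef
  set T' : Subring E := Subring.closure ((T : Set E) ∪ (Set.range x' ∪ Set.range z)) with hT'def
  set B : Subring E := locAtCentre T O with hBdef
  haveI : IsLocalRing B := isLocalRing_locAtCentre hTO
  haveI := hreg
  haveI : IsNoetherianRing B := inferInstance
  have hBO : B ≤ O.toSubring := locAtCentre_le hTO
  have hTB : T ≤ B := le_locAtCentre T O
  have hmem : ∀ b : B, b ∈ maximalIdeal B ↔ O.valuation (b : E) < 1 := mem_maximalIdeal_locAtCentre_iff hTO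
  obtain ⟨hηT, hηv, hwB, hwv, hηw⟩ := hpiv
  -- iterates of `σ` and the inverses `z i = (1 + σ^i η)⁻¹ ∈ B`
  have hσiO : ∀ (i : ℕ) (b : E), b ∈ O ↔ (σ ^ i) b ∈ O := mem_iff_pow_apply_mem O hσO
  have hσiT : ∀ (i : ℕ) {b : E}, b ∈ T → (σ ^ i) b ∈ T := fun i b hb => pow_apply_mem_of_stable hσT i hb
  have hσiηv : ∀ i : ℕ, O.valuation ((σ ^ i) η) < 1 := fun i => valuation_apply_lt_one O (hσiO i) hηv
  have h1i : ∀ i : ℕ, O.valuation (1 + (σ ^ i) η) = 1 := fun i => valuation_one_add_eq_one O (hσiηv i)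
  have hzB : ∀ i, z i ∈ B := fun i =>
    inv_mem_locAtCentre (hTB (T.add_mem T.one_mem (hσiT i hηT))) (h1i i)
  -- `T′` basics
  have hTT' : T ≤ T' := fun b hb => Subring.subset_closure (Or.inl hb)
  have hx'T' : ∀ j, x' j ∈ T' := fun j => Subring.subset_closure (Or.inr (Or.inl ⟨j, rfl⟩))
  have hzT' : ∀ i, z i ∈ T' := fun i => Subring.subset_closure (Or.inr (Or.inr ⟨i, rfl⟩))
  have hT'O : T' ≤ O.toSubring := Subring.closure_le.mpr (by
    rintro b (hb | ⟨j, rfl⟩ | ⟨i, rfl⟩)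
    · exact hTO hb
    · exact (hx' j).2.1
    · exact hBO (hzB i))
  set B' : Subring E := locAtCentre T' O with hB'def
  have hBB' : B ≤ B' := locAtCentre_mono O hTT'
  have hT'B' : T' ≤ B' := le_locAtCentre T' O
  have h1ηT' : 1 + η ∈ T' := T'.add_mem T'.one_mem (hTT' hηT)
  have hinvT' : (1 + η)⁻¹ ∈ T' := by
    have h := hzT' ⟨0, hp.out.pos⟩
    simp only [hzdef, pow_zero, RingAut.one_apply] at h
    exact h
  have hzpowT' : ∀ n : ℤ, (1 + η) ^ n ∈ T' := zpow_mem_of_inv_mem T' h1ηT' hinvT'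
  -- (1) `σ`-STABILITY of `T′`: `σ x′_j = x′_j (1 + η)^{N_j}`, `σ` permutes the `z i` (`σ^p = 1`)
  have hσz : ∀ i : Fin p, ∃ i' : Fin p, σ (z i) = z i' := by
    intro i
    refine ⟨⟨((i : ℕ) + 1) % p, Nat.mod_lt _ hp.out.pos⟩, ?_⟩
    have e : σ ^ ((i : ℕ) + 1) = σ ^ (((i : ℕ) + 1) % p) := by
      conv_lhs => rw [← Nat.mod_add_div ((i : ℕ) + 1) p, pow_add, pow_mul, hσp, one_pow, mul_one]
    simp only [hzdef]
    rw [map_inv₀, map_add, map_one, ← RingAut.mul_apply, ← pow_succ', e]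
  have hσT' : ∀ b ∈ T', σ b ∈ T' := by
    intro b hb
    induction hb using Subring.closure_induction with
    | mem b hb =>
        rcases hb with hb | ⟨j, rfl⟩ | ⟨i, rfl⟩
        · exact hTT' (hσT b hb)
        · rw [htw j]
          exact T'.mul_mem (hx'T' j) (hzpowT' (N j))
        · obtain ⟨i', e⟩ := hσz i
          rw [e]
          exact hzT' i'
    | zero => rw [map_zero]; exact T'.zero_mem
    | one => rw [map_one]; exact T'.one_mem
    | add a b _ _ ha hb => rw [map_add]; exact T'.add_mem ha hb
    | neg a _ ha => rw [map_neg]; exact T'.neg_mem ha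
    | mul a b _ _ ha hb => rw [map_mul]; exact T'.mul_mem ha hb
  -- (2) REGULARITY of `T′_𝔪′`: base change to `B`, drop the units `z i ∈ B`, toric chart theorem by name
  have hE2 : Subring.closure ((B : Set E) ∪ (Set.range x' ∪ Set.range z)) =
      Subring.closure ((B : Set E) ∪ Set.range x') := by
    refine le_antisymm (Subring.closure_le.mpr ?_)
      (Subring.closure_mono (Set.union_subset_union_right _ Set.subset_union_left))
    rintro b (hb | ⟨j, rfl⟩ | ⟨i, rfl⟩)
    · exact Subring.subset_closure (Or.inl hb)
    · exact Subring.subset_closure (Or.inr ⟨j, rfl⟩)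
    · exact Subring.subset_closure (Or.inl (hzB i))
  have hE1 : locAtCentre T' O = locAtCentre (Subring.closure ((B : Set E) ∪ Set.range x')) O := by
    rw [← hE2, hBdef, locAtCentre_closure_locAtCentre_union]
  let G : Set B := Set.range fun i => (⟨x i, (hx i).1⟩ : B)
  have hcoe : ∀ g : Fin d → B, (((∑ i, g i : B)) : E) = ∑ i, (g i : E) := fun g =>
    map_sum B.subtype g Finset.univ
  have hG : Ideal.span G = maximalIdeal B := by
    refine le_antisymm (Ideal.span_le.mpr ?_) fun a ha => ?_
    · rintro _ ⟨i, rfl⟩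
      exact (hmem _).mpr (hx i).2
    · obtain ⟨c, hc, hsum⟩ := hgen a a.2 ((hmem a).mp ha)
      have e : a = ∑ i, (⟨c i, hc i⟩ : B) * ⟨x i, (hx i).1⟩ := by
        apply Subtype.ext
        rw [hcoe]
        exact hsum
      rw [e]
      exact Ideal.sum_mem _ fun i _ => Ideal.mul_mem_left _ _ (Ideal.subset_span ⟨i, rfl⟩)
  have hGmon : ∀ g ∈ G, ∃ c : Fin d → ℕ, ((g : B) : E) = ∏ j, x' j ^ c j := by
    rintro _ ⟨i, rfl⟩
    exact ⟨A i, hmon i⟩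
  set X'f : Finset E := Finset.univ.image x' with hX'f
  have hX'coe : (X'f : Set E) = Set.range x' := by simp [hX'f]
  have hb : ∀ y ∈ X'f, ∃ a e : B, (e : E) ≠ 0 ∧ y = a / e := by
    intro y hy
    obtain ⟨j, -, rfl⟩ := Finset.mem_image.mp hy
    obtain ⟨hx0, -, -, a, b, ha, hb, hab⟩ := hx' j
    refine ⟨⟨a, hTB ha⟩, ⟨b, hTB hb⟩, fun hb0 => hx0 ?_, hab⟩
    have hb0' : b = 0 := hb0
    rw [hab, hb0', div_zero]
  have hXO : Subring.closure ((B : Set E) ∪ (X'f : Set E)) ≤ O.toSubring := by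
    rw [hX'coe]
    exact Subring.closure_le.mpr (Set.union_subset hBO (by rintro _ ⟨j, rfl⟩; exact (hx' j).2.1))
  have hdomB : ∀ r : B, r ∈ maximalIdeal B → O.valuation (r : E) < 1 := fun r hr => (hmem r).mp hr
  have h1nm : (1 : B) ∉ maximalIdeal B := fun h => by
    have h' := (hmem 1).mp h
    rw [OneMemClass.coe_one, map_one] at h'
    exact lt_irrefl _ h'
  have halg : ∀ y : O, ∃ q : Polynomial B, (∃ i, q.coeff i ∉ maximalIdeal B) ∧
      O.valuation (Polynomial.aeval (y : E) q) < 1 := by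
    intro y
    obtain ⟨c, hcS, hvc⟩ := hres y y.2
    refine ⟨X - C (⟨c, hTB (hST hcS)⟩ : B), ⟨1, ?_⟩, ?_⟩
    · rw [coeff_sub, coeff_X_one, coeff_C, if_neg one_ne_zero, sub_zero]
      exact h1nm
    · have e : Polynomial.aeval (y : E) (X - C (⟨c, hTB (hST hcS)⟩ : B)) = y - c := by
        rw [map_sub, aeval_X, aeval_C]
        rfl
      rw [e]
      exact hvc
  have hdim' : ringKrullDim (locAtCentre (Subring.closure ((B : Set E) ∪ Set.range x')) O) = d := by
    have h := ringKrullDim_locAtCentre_closure_eq O hTuc hBO hdomB halg X'f hb hXO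
    rw [hX'coe] at h
    rw [h, hBdef, hdim]
  have hregX : IsRegularLocalRing (locAtCentre (Subring.closure ((B : Set E) ∪ Set.range x')) O) :=
    isRegularLocalRing_locAtCentre_adjoin_monomials O B hBO hmem x' (fun j => (hx' j).2.1) G hG hGmon hdim'
  have hreg' : IsRegularLocalRing (locAtCentre T' O) := by
    rw [hE1]
    exact hregX
  -- (3) THE GENERATOR: Frobenius + lucky divisibility on `B′`, Nakayama on `B`, derivation rule along `T′`
  have hσB' : ∀ b ∈ B', σ b ∈ B' := fun b hb => apply_mem_locAtCentre O hσO hσT' hb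
  have hx'B' : ∀ j, x' j ∈ B' ∧ x' j ≠ 0 := fun j => ⟨hT'B' (hx'T' j), (hx' j).1⟩
  obtain ⟨j₀, hδ0, hdiv⟩ :=
    exists_twist_eq_mul_of_lucky O p hT'O hx'B' ⟨hBB' hwB, hwv⟩ hηv hηw (hT'B' hinvT') hL
  have hδe : ∀ j, σ (x' j) - x' j = x' j * ((1 + η) ^ N j - 1) := fun j => by rw [htw j]; ring
  set δ : E := σ (x' j₀) - x' j₀ with hδ
  have hPx' : ∀ j, x' j ∈ B' ∧ ∃ c ∈ B', σ (x' j) - x' j = δ * c := fun j => by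
    obtain ⟨c, hc, e⟩ := hdiv j
    exact ⟨(hx'B' j).1, c, hc, by rw [hδe j, e, hδ, hδe j₀]⟩
  have hPx : ∀ i, x i ∈ B' ∧ ∃ c ∈ B', σ (x i) - x i = δ * c := fun i => by
    have hxi : x i ∈ Subring.closure (Set.range x') := by
      rw [hmon i]
      exact Subring.prod_mem _ fun j _ =>
        Subring.pow_mem _ (Subring.subset_closure (Set.mem_range_self j)) _
    exact apply_sub_mem_of_mem_closure hσB' δ (by rintro _ ⟨j, rfl⟩; exact hPx' j) hxi
  have hresB : ∀ b ∈ B, ∃ c ∈ B, σ c = c ∧ O.valuation (b - c) < 1 := fun b hb => by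
    obtain ⟨c, hcS, hvc⟩ := hres b (hBO hb)
    exact ⟨c, hTB (hST hcS), hσS c hcS, hvc⟩
  choose e' he' he'e using fun i => (hPx i).2
  have hPB : ∀ b ∈ B, b ∈ B' ∧ ∃ c ∈ B', σ b - b = δ * c := by
    intro b hb
    obtain ⟨c, hc, e⟩ := exists_apply_sub_eq_sum O hTO hσO hσT hresB hx hgen hb
    refine ⟨hBB' hb, ∑ i, c i * e' i, B'.sum_mem fun i _ => B'.mul_mem (hBB' (hc i)) (he' i), ?_⟩
    rw [e, Finset.mul_sum]
    exact Finset.sum_congr rfl fun i _ => by rw [he'e i]; ring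
  have hPT' : ∀ b ∈ T', b ∈ B' ∧ ∃ c ∈ B', σ b - b = δ * c := fun b hb =>
    apply_sub_mem_of_mem_closure hσB' δ (by
      rintro b (hb | ⟨j, rfl⟩ | ⟨i, rfl⟩)
      · exact hPB b (hTB hb)
      · exact hPx' j
      · exact hPB _ (hzB i)) hb
  refine ⟨hT'O, hσT', hreg', j₀, hx'T' j₀, fun e => hδ0 ?_, fun b hb => ?_⟩
  · rw [← hδe j₀, e, sub_self]
  · obtain ⟨-, c, hc, e⟩ := hPT' b hb
    exact ⟨c, hc, e⟩

end Chart

end Summit.ResolutionOfSingularities.ResolutionOfSingularities.Theorems.WildLogDiagonalLU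

end
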